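import Mathlib
import HarnessLib
import Literature.Geometry.DiscreteGeometry.KissingPatterns
import Literature.Algebra.EuclideanLattices.FccBccLattices

/-!
# FrustratedLawDichotomy · crux `AperiodicFrustratedLawGap` (stmt-AtomisticToContinuum-27623) — KR_gap: THE THIRTEENTH-NEIGHBOUR GAP OF A
# NEAR-CUBOCTAHEDRAL SHELL (decomp-a2c, prover hand 2, structural share, generation 7; route-independent module; critic row 388 order
# «split KR := KR_shape ∧ KR_gap, prove KR_gap now»)

The kissing-rigidity hypothesis `KR` of `FrustratedLawDichotomyChargedGapRigidityDoor` («charge-free at `1/100` ⟹ robustly good») splits into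
KR_shape (twelve `1/100`-bonds with ring number `4` ⟹ an fcc/hcp shell within `η < 1/20`) and KR_gap (given such a shell, no further atom can sit
inside the `13/10·d` sphere).  This file proves KR_gap for the fcc (cuboctahedron) pattern, as elementary geometry:

* `fcc_covering` : the COVERING CONSTANT of the cuboctahedron is `45°` — for every `x ∈ ℝ³` and `d ≥ 0` some pattern vector `u` has
  `‖x − d•u‖² ≤ ‖x‖² + d² − √2·d·‖x‖` (i.e. `⟪x, u⟫ ≥ ‖x‖/√2`; proof: drop the coordinate of least modulus, keep the signs of the other two);
* `thirteenth_neighbour_gap` : for ANY finite pattern with that covering property, a shell `t : Pat → ℝ³` with `‖(t u − p) − d•A u‖ ≤ η·d`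
  (`A` a linear isometry, `η ≤ 1/20`) leaves no room at distances `[d, 131/100·d]` from `p` for a point `q` that keeps distance `≥ 100/101·d` from
  every shell atom: some `t u` has `dist q (t u) < 100/101·d` (numerically `√(1.31² + 1 − √2·1.31) + 1/20 = 0.979 < 0.990`);
* `thirteenth_neighbour_gap_fcc` : the fcc instance.

Reading for KR: at a charge-free(1/100) site `p` with nearest-neighbour distance `d`, every atom `q ≠ t u` is at distance `≥ nn(t u) ≥ d/1.01`
from each bonded neighbour `t u` and `≥ d` from `p`; so once KR_shape places the twelve bonded neighbours within `η·d` of a rotated cuboctahedron,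
NO atom lies in `[d, 131/100·d]` around `p` other than the shell — the clean-gap clause of robust goodness with `γ = d/100`.  The hcp
(anticuboctahedron) instance has the same covering constant (all faces are unit triangles / squares inscribed in the unit sphere; reduce to the
nine vectors shared with the cuboctahedron by the mirror symmetry in the hexagonal plane) and is left to a sequel.  `[folklore]`.
-/

noncomputable section

namespace Summit.AtomisticToContinuum.Crystallization.Theorems.FrustratedLawDichotomyThirteenthNeighbourGap

open Literature.Geometry.DiscreteGeometry
open Literature.Algebra.EuclideanLattices (norm_sq_fin_three)

/-- A sign `s ∈ {±1}` (as an integer) with `s·t = |t|`. [folklore] -/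
theorem exists_sign (t : ℝ) : ∃ s : ℤ, (s = 1 ∨ s = -1) ∧ (s : ℝ) * t = |t| ∧ ((s : ℝ)) ^ 2 = 1 := by
  by_cases h : 0 ≤ t
  · exact ⟨1, Or.inl rfl, by rw [abs_of_nonneg h]; simp, by simp⟩
  · exact ⟨-1, Or.inr rfl, by rw [abs_of_neg (not_le.1 h)]; simp, by simp⟩

/-- The sign vectors with one zero coordinate are fcc minimal vectors. [folklore] -/
theorem mem_fccInt_of_signs (s₀ s₁ : ℤ) (h₀ : s₀ = 1 ∨ s₀ = -1) (h₁ : s₁ = 1 ∨ s₁ = -1) :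
    ![s₀, s₁, 0] ∈ fccInt ∧ ![s₀, 0, s₁] ∈ fccInt ∧ ![0, s₀, s₁] ∈ fccInt := by
  rcases h₀ with rfl | rfl <;> rcases h₁ with rfl | rfl <;> decide

/-- **The real inequality behind the covering constant**: if `|x₂| ≤ |x₀|, |x₁|` and `σᵢ xᵢ = |xᵢ|`, `σᵢ² = 1`, then
`(x₀ − dσ₀/√2)² + (x₁ − dσ₁/√2)² + x₂² ≤ (x₀² + x₁² + x₂²) + d² − √2·d·√(x₀² + x₁² + x₂²)` for `d ≥ 0`. [folklore] -/
theorem covering_aux (x₀ x₁ x₂ d σ₀ σ₁ : ℝ) (hσ₀ : σ₀ * x₀ = |x₀|) (hσ₁ : σ₁ * x₁ = |x₁|) (hσ₀' : σ₀ ^ 2 = 1)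
    (hσ₁' : σ₁ ^ 2 = 1) (h₀ : |x₂| ≤ |x₀|) (h₁ : |x₂| ≤ |x₁|) (hd : 0 ≤ d) :
    (x₀ - d * ((Real.sqrt 2)⁻¹ * σ₀)) ^ 2 + (x₁ - d * ((Real.sqrt 2)⁻¹ * σ₁)) ^ 2 + (x₂ - d * ((Real.sqrt 2)⁻¹ * 0)) ^ 2 ≤
      (x₀ ^ 2 + x₁ ^ 2 + x₂ ^ 2) + d ^ 2 - Real.sqrt 2 * d * Real.sqrt (x₀ ^ 2 + x₁ ^ 2 + x₂ ^ 2) := by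
  have hs2 : (0 : ℝ) < Real.sqrt 2 := by positivity
  have hs2sq : Real.sqrt 2 ^ 2 = 2 := Real.sq_sqrt (by norm_num)
  have hc2 : 2 * ((Real.sqrt 2)⁻¹) ^ 2 = 1 := by rw [inv_pow, hs2sq]; norm_num
  have h2c : 2 * (Real.sqrt 2)⁻¹ = Real.sqrt 2 := by
    rw [mul_inv_eq_iff_eq_mul₀ hs2.ne']; exact (Real.mul_self_sqrt (by norm_num : (0 : ℝ) ≤ 2)).symm
  -- the norm is at most `|x₀| + |x₁|`
  have hsum : Real.sqrt (x₀ ^ 2 + x₁ ^ 2 + x₂ ^ 2) ≤ |x₀| + |x₁| := by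
    rw [Real.sqrt_le_left (by positivity)]
    nlinarith [mul_le_mul h₀ h₁ (abs_nonneg _) (abs_nonneg _), sq_abs x₀, sq_abs x₁, sq_abs x₂, abs_nonneg x₂]
  -- expand the left-hand side
  have hlhs : (x₀ - d * ((Real.sqrt 2)⁻¹ * σ₀)) ^ 2 + (x₁ - d * ((Real.sqrt 2)⁻¹ * σ₁)) ^ 2 + (x₂ - d * ((Real.sqrt 2)⁻¹ * 0)) ^ 2 =
      (x₀ ^ 2 + x₁ ^ 2 + x₂ ^ 2) + d ^ 2 - Real.sqrt 2 * d * (|x₀| + |x₁|) := by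
    rw [← hσ₀, ← hσ₁]
    linear_combination (d ^ 2 * ((Real.sqrt 2)⁻¹) ^ 2) * hσ₀' + (d ^ 2 * ((Real.sqrt 2)⁻¹) ^ 2) * hσ₁' + d ^ 2 * hc2 -
      d * (σ₀ * x₀ + σ₁ * x₁) * h2c
  rw [hlhs]
  have := mul_le_mul_of_nonneg_left hsum (mul_nonneg hs2.le hd)
  linarith

/-- **COVERING CONSTANT OF THE CUBOCTAHEDRON**: for every `x ∈ ℝ³` and `d ≥ 0` some fcc pattern vector `u` has
`‖x − d•u‖² ≤ ‖x‖² + d² − √2·d·‖x‖`. [folklore] -/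
theorem fcc_covering (x : EuclideanSpace ℝ (Fin 3)) {d : ℝ} (hd : 0 ≤ d) :
    ∃ u ∈ fccKissingPattern, ‖x - d • u‖ ^ 2 ≤ ‖x‖ ^ 2 + d ^ 2 - Real.sqrt 2 * d * ‖x‖ := by
  have hnorm : ‖x‖ = Real.sqrt (x 0 ^ 2 + x 1 ^ 2 + x 2 ^ 2) := by
    rw [← norm_sq_fin_three, Real.sqrt_sq (norm_nonneg _)]
  have h2 : ((2 : ℕ) : ℝ) = 2 := by norm_num
  -- the candidate vector for a given choice of the dropped coordinate
  have cand : ∀ w : Fin 3 → ℤ, w ∈ fccInt →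
      ‖x - d • ((Real.sqrt ((2 : ℕ) : ℝ))⁻¹ • intVec w)‖ ^ 2 =
        (x 0 - d * ((Real.sqrt 2)⁻¹ * w 0)) ^ 2 + (x 1 - d * ((Real.sqrt 2)⁻¹ * w 1)) ^ 2 + (x 2 - d * ((Real.sqrt 2)⁻¹ * w 2)) ^ 2 := by
    intro w _
    rw [norm_sq_fin_three]
    simp only [PiLp.sub_apply, PiLp.smul_apply, smul_eq_mul, intVec_apply, h2]
  have mem : ∀ w : Fin 3 → ℤ, w ∈ fccInt → (Real.sqrt ((2 : ℕ) : ℝ))⁻¹ • intVec w ∈ fccKissingPattern :=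
    fun w hw => Finset.mem_image_of_mem _ hw
  -- which coordinate has least modulus
  have htri : (|x 2| ≤ |x 0| ∧ |x 2| ≤ |x 1|) ∨ (|x 1| ≤ |x 0| ∧ |x 1| ≤ |x 2|) ∨ (|x 0| ≤ |x 1| ∧ |x 0| ≤ |x 2|) := by
    rcases le_total |x 2| |x 1| with h | h
    · rcases le_total |x 2| |x 0| with h' | h'
      · exact Or.inl ⟨h', h⟩
      · exact Or.inr (Or.inr ⟨h'.trans h, h'⟩)
    · rcases le_total |x 1| |x 0| with h' | h'
      · exact Or.inr (Or.inl ⟨h', h⟩)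
      · exact Or.inr (Or.inr ⟨h', h'.trans h⟩)
  have e2 : ∀ a b c : ℤ, ((![a, b, c] : Fin 3 → ℤ) 0 = a) ∧ ((![a, b, c] : Fin 3 → ℤ) 1 = b) ∧ ((![a, b, c] : Fin 3 → ℤ) 2 = c) :=
    fun a b c => ⟨rfl, rfl, rfl⟩
  obtain ⟨s₀, hs₀, hs₀x, hs₀sq⟩ := exists_sign (x 0)
  obtain ⟨s₁, hs₁, hs₁x, hs₁sq⟩ := exists_sign (x 1)
  obtain ⟨s₂, hs₂, hs₂x, hs₂sq⟩ := exists_sign (x 2)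
  rcases htri with hA | hB | hC
  · obtain ⟨hw, -, -⟩ := mem_fccInt_of_signs _ _ hs₀ hs₁
    refine ⟨_, mem _ hw, ?_⟩
    obtain ⟨e₀, e₁, e₂⟩ := e2 s₀ s₁ 0
    rw [cand _ hw, e₀, e₁, e₂, norm_sq_fin_three x, hnorm, Int.cast_zero]
    exact covering_aux (x 0) (x 1) (x 2) d _ _ hs₀x hs₁x hs₀sq hs₁sq hA.1 hA.2 hd
  · obtain ⟨-, hw, -⟩ := mem_fccInt_of_signs _ _ hs₀ hs₂
    refine ⟨_, mem _ hw, ?_⟩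
    obtain ⟨e₀, e₁, e₂⟩ := e2 s₀ 0 s₂
    rw [cand _ hw, e₀, e₁, e₂, norm_sq_fin_three x, hnorm, Int.cast_zero]
    have := covering_aux (x 0) (x 2) (x 1) d _ _ hs₀x hs₂x hs₀sq hs₂sq hB.1 hB.2 hd
    have hperm : x 0 ^ 2 + x 2 ^ 2 + x 1 ^ 2 = x 0 ^ 2 + x 1 ^ 2 + x 2 ^ 2 := by ring
    rw [hperm] at this
    simp only [mul_zero, sub_zero] at this ⊢
    linarith
  · obtain ⟨-, -, hw⟩ := mem_fccInt_of_signs _ _ hs₁ hs₂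
    refine ⟨_, mem _ hw, ?_⟩
    obtain ⟨e₀, e₁, e₂⟩ := e2 0 s₁ s₂
    rw [cand _ hw, e₀, e₁, e₂, norm_sq_fin_three x, hnorm, Int.cast_zero]
    have := covering_aux (x 1) (x 2) (x 0) d _ _ hs₁x hs₂x hs₁sq hs₂sq hC.1 hC.2 hd
    have hperm : x 1 ^ 2 + x 2 ^ 2 + x 0 ^ 2 = x 0 ^ 2 + x 1 ^ 2 + x 2 ^ 2 := by ring
    rw [hperm] at this
    simp only [mul_zero, sub_zero] at this ⊢
    linarith

/-- **THE THIRTEENTH-NEIGHBOUR GAP** for a pattern with covering constant `45°` (module docstring). [folklore] -/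
theorem thirteenth_neighbour_gap {Pat : Finset (EuclideanSpace ℝ (Fin 3))}
    (hcov : ∀ x : EuclideanSpace ℝ (Fin 3), ∀ d : ℝ, 0 ≤ d → ∃ u ∈ Pat, ‖x - d • u‖ ^ 2 ≤ ‖x‖ ^ 2 + d ^ 2 - Real.sqrt 2 * d * ‖x‖)
    {p q : EuclideanSpace ℝ (Fin 3)} {d η : ℝ} {A : EuclideanSpace ℝ (Fin 3) →ₗᵢ[ℝ] EuclideanSpace ℝ (Fin 3)}
    {t : ↥Pat → EuclideanSpace ℝ (Fin 3)} (hd : 0 < d) (hη : η ≤ 1 / 20)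
    (ht : ∀ u : ↥Pat, ‖(t u - p) - d • A (u : EuclideanSpace ℝ (Fin 3))‖ ≤ η * d)
    (hq₁ : d ≤ dist q p) (hq₂ : dist q p ≤ 131 / 100 * d) :
    ∃ u : ↥Pat, dist q (t u) < 100 / 101 * d := by
  -- pull `q − p` back through the isometry
  set B := A.toLinearIsometryEquiv rfl with hB
  set x := B.symm (q - p) with hx
  have hAx : A x = q - p := by
    rw [← LinearIsometry.toLinearIsometryEquiv_apply A rfl, hx, LinearIsometryEquiv.apply_symm_apply]
  have hxn : ‖x‖ = dist q p := by rw [hx, LinearIsometryEquiv.norm_map, dist_eq_norm]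
  obtain ⟨u, hu, hux⟩ := hcov x d hd.le
  -- `‖(q − p) − d•A u‖ = ‖x − d•u‖ ≤ 0.94·d`
  have hiso : ‖(q - p) - d • A u‖ = ‖x - d • u‖ := by
    rw [← hAx, ← A.map_smul, ← A.map_sub, A.norm_map]
  have hs2 : (141421 / 100000 : ℝ) ≤ Real.sqrt 2 := by
    rw [show (141421 / 100000 : ℝ) = Real.sqrt ((141421 / 100000) ^ 2) from (Real.sqrt_sq (by norm_num)).symm]
    exact Real.sqrt_le_sqrt (by norm_num)
  have hr := hxn ▸ hux
  have hbound : ‖x - d • u‖ ^ 2 ≤ (47 / 50 * d) ^ 2 := by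
    have h1 : Real.sqrt 2 * d * dist q p ≥ 141421 / 100000 * d * dist q p := by
      have : 0 ≤ d * dist q p := by positivity
      nlinarith
    have h2 : (dist q p - d) * (dist q p - 131 / 100 * d) ≤ 0 := by nlinarith
    rw [hxn] at hux
    nlinarith
  have hle : ‖x - d • u‖ ≤ 47 / 50 * d :=
    (pow_le_pow_iff_left₀ (norm_nonneg _) (by positivity) two_ne_zero).1 hbound
  refine ⟨⟨u, hu⟩, ?_⟩
  calc dist q (t ⟨u, hu⟩) = ‖((q - p) - d • A u) - ((t ⟨u, hu⟩ - p) - d • A u)‖ := by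
        rw [dist_eq_norm]; congr 1; abel
    _ ≤ ‖(q - p) - d • A u‖ + ‖(t ⟨u, hu⟩ - p) - d • A u‖ := norm_sub_le _ _
    _ ≤ 47 / 50 * d + η * d := add_le_add (hiso ▸ hle) (ht ⟨u, hu⟩)
    _ < 100 / 101 * d := by nlinarith

/-- **KR_gap, fcc instance**: a shell within `η ≤ 1/20` of a rotated cuboctahedron of scale `d` around `p` leaves every point `q` with
`d ≤ dist q p ≤ 131/100·d` within `< 100/101·d` of some shell atom. [folklore] -/
theorem thirteenth_neighbour_gap_fcc {p q : EuclideanSpace ℝ (Fin 3)} {d η : ℝ}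
    {A : EuclideanSpace ℝ (Fin 3) →ₗᵢ[ℝ] EuclideanSpace ℝ (Fin 3)} {t : ↥fccKissingPattern → EuclideanSpace ℝ (Fin 3)}
    (hd : 0 < d) (hη : η ≤ 1 / 20) (ht : ∀ u : ↥fccKissingPattern, ‖(t u - p) - d • A (u : EuclideanSpace ℝ (Fin 3))‖ ≤ η * d)
    (hq₁ : d ≤ dist q p) (hq₂ : dist q p ≤ 131 / 100 * d) :
    ∃ u : ↥fccKissingPattern, dist q (t u) < 100 / 101 * d :=
  thirteenth_neighbour_gap (fun x _ hd' => fcc_covering x hd') hd hη ht hq₁ hq₂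

end Summit.AtomisticToContinuum.Crystallization.Theorems.FrustratedLawDichotomyThirteenthNeighbourGap

end
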